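import Literature.NumberTheory.Sieve.PolynomialCongruences
import HarnessLib

/-!
# Roots of polynomial congruences to prime moduli: Weyl's criterion, both halves

Topic `Literature/NumberTheory/Sieve`, companion of `PolynomialCongruences.lean`.  Everything in
this file is PROVED; it contains no named fact.

The equidistribution theorems for the roots of a quadratic congruence to prime moduli
(Duke–Friedlander–Iwaniec 1995, negative discriminant; Tóth 2000, positive discriminant) are
PRINTED as statements of uniform distribution modulo one of the fractions `ν/p` (`p` prime,
`0 ≤ ν < p`, `f(ν) ≡ 0 (mod p)`), arranged by increasing `p`: "the number of pairs `(p, ν)` with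
`p ≤ x`, `αp ≤ ν < βp`, `f(ν) ≡ 0 (mod p)` is `∼ (β − α) π(x)` for `0 ≤ α < β ≤ 1`"
[cite: DukeFriedlanderIwaniec1995, main theorem] (wording of the review Zbl 0840.11003), whereas the
tree vendors them (`Literature.NumberTheory.Sieve.dukeFriedlanderIwaniecToth_quadraticRoots_primeModuli`) in the Weyl-sum
form `∑_{p ≤ x} ∑_{ν} e(hν/p) = o(x / log x)` for every integer `h ≠ 0` — the estimate the papers
actually establish ("With the Weyl principle, the proof consists of showing
`∑_{p ≤ x} ρ_h(p) = o(π(x))` for all `h ≠ 0`", loc. cit.; the same Weyl-sum form is how the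
theorem is quoted in [cite: Harman1997, p. 171 item 7]).  This file proves, for an ARBITRARY
`f ∈ ℤ[X]` and an ARBITRARY normalising function `g : ℕ → ℝ`, that the two forms are equivalent
(Weyl's criterion [cite: Weyl1916, §1 Satz 1, p. 315], in the block-by-block form appropriate to
this triangular array; a modern statement is [cite: Kowalski2021, Theorem B.6.3]), so that neither
vendored form is stronger than what is printed:

* `primeRootPairCount f α β P = #{(p, ν) : p ≤ P prime, 0 ≤ ν < p, p ∣ f(ν), α ≤ ν/p < β}`, with
  `primeRootPairCount f 0 1 P = ∑_{p ≤ P} ρ_f(p) =: N(P)` the number of fractions;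
* (counting ⇒ Weyl sums) `isLittleO_sum_polyRootWeylSum_of_counting` — if
  `#{… ∈ [α, β)} = (β − α) g(P) + o(g(P))` for all `0 ≤ α < β ≤ 1` and `N(P) = O(g(P))`, then
  `∑_{p ≤ P} S_f(h, p) = o(g(P))` for every integer `h ≠ 0` (`S_f(h, p) = polyRootWeylSum f p h`).
  Proof: cut `[0, 1)` into `K > |h|` equal parts; on the `k`-th part `e(hν/p)` is within `2π|h|/K`
  of `e(hk/K)`, the parts carry `g/K + o(g)` points each, and `∑_{k < K} e(hk/K) = 0`;
* (Weyl sums ⇒ counting) `counting_of_weylSums` — if `∑_{p ≤ P} S_f(h, p) = o(g(P))` for every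
  `h ≠ 0` and `N(P) = g(P) + o(g(P))`, then `#{… ∈ [α, β)} = (β − α) g(P) + o(g(P))` for all
  `0 ≤ α < β ≤ 1`.  Proof (Weyl's): the test sums `∑ F(ν/p)` of the characters `F = e(h·)` are
  `(∫ F) g + o(g)` by hypothesis, hence so are those of trigonometric polynomials, hence (uniform
  density, Mathlib's `span_fourier_closure_eq_top`) those of every continuous `F : ℝ/ℤ → ℂ`
  (`isWeylGood_of_weylSums`), and the indicator of an arc is squeezed between two Urysohn
  functions whose integrals differ by at most `4δ`;
* `counting_iff_weylSums` — the equivalence, and `counting_iff_weylSums_pairCount`, its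
  specialisation to the classical normalisation `g = N` (uniform distribution of the sequence of
  fractions taken block by block).

The normaliser is kept abstract because the sources use both `g = π` (Duke–Friedlander–Iwaniec)
and `g = N` ("the roots … are uniformly distributed", Tóth); for irreducible `f` the two agree
since `N(P) ∼ π(P)` by the prime ideal theorem (proved in the companion file on the count of
roots to prime moduli).

## References

* H. Weyl, Math. Ann. 77 (1916) 313–352, §1 Satz 1 p. 315 (the criterion, proved there exactly as
  here: characters ⇒ trigonometric polynomials ⇒ continuous test functions by uniform
  approximation ⇒ step functions squeezed between two continuous ones). [cite: Weyl1916, §1 Satz 1]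
* E. Kowalski, *An introduction to probabilistic number theory* (CUP, 2021), Theorem B.6.3
  (Weyl's criterion on a compact abelian group). [cite: Kowalski2021, Theorem B.6.3]
* W. Duke, J. B. Friedlander, H. Iwaniec, Ann. of Math. 141 (1995) 423–441 (statement in counting
  form, reduction to Weyl sums). [cite: DukeFriedlanderIwaniec1995, main theorem]
* G. Harman, in *Sieve Methods, Exponential Sums, and their Applications in Number Theory*
  (Cardiff 1995), LMS Lecture Note Ser. 237 (1997) 161–173, p. 171 item 7 (the theorem quoted in
  Weyl-sum form). [cite: Harman1997, p. 171]
-/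

noncomputable section

open scoped BigOperators Polynomial
open Filter Asymptotics Polynomial Finset

namespace Literature.NumberTheory.Sieve

/-! ### The pair count -/

/-- **The number of pairs `(p, ν)`** with `p ≤ P` prime, `0 ≤ ν < p`, `f(ν) ≡ 0 (mod p)` and
`α ≤ ν/p < β`: the counting function of the fractions `ν/p` arranged by increasing prime modulus,
taken at the end of the block of modulus `P`. [folklore] -/
def primeRootPairCount (f : ℤ[X]) (α β : ℝ) (P : ℕ) : ℕ :=
  ∑ p ∈ Nat.primesLE P,
    #((range p).filter fun ν : ℕ => (p : ℤ) ∣ f.eval (ν : ℤ) ∧ α ≤ (ν : ℝ) / p ∧ (ν : ℝ) / p < β)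

/-- Unfolding `primeRootPairCount`. [folklore] -/
theorem primeRootPairCount_def (f : ℤ[X]) (α β : ℝ) (P : ℕ) :
    primeRootPairCount f α β P = ∑ p ∈ Nat.primesLE P,
      #((range p).filter fun ν : ℕ =>
        (p : ℤ) ∣ f.eval (ν : ℤ) ∧ α ≤ (ν : ℝ) / p ∧ (ν : ℝ) / p < β) :=
  rfl

/-- On `[0, 1)` the interval condition is void: the total pair count is `∑_{p ≤ P} ρ_f(p)`.
[folklore] -/
theorem primeRootPairCount_zero_one (f : ℤ[X]) (P : ℕ) :
    primeRootPairCount f 0 1 P = ∑ p ∈ Nat.primesLE P, polyRootCountMod ![f] p := by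
  unfold primeRootPairCount
  refine sum_congr rfl fun p hp => ?_
  rw [← card_filter_dvd_eval_eq_polyRootCountMod]
  congr 1
  refine filter_congr fun ν hν => ?_
  have hp0 : (0 : ℝ) < p := by exact_mod_cast (Nat.mem_primesLE.mp hp).2.pos
  have hνp : (ν : ℝ) < p := by exact_mod_cast mem_range.mp hν
  simp only [and_iff_left_iff_imp]
  intro _
  exact ⟨by positivity, (div_lt_one hp0).2 hνp⟩

/-- The pair count as a double sum of an indicator over the roots. [folklore] -/
theorem primeRootPairCount_eq_sum_sum (f : ℤ[X]) (α β : ℝ) (P : ℕ) :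
    (primeRootPairCount f α β P : ℝ) = ∑ p ∈ Nat.primesLE P,
      ∑ ν ∈ (range p).filter (fun ν : ℕ => (p : ℤ) ∣ f.eval (ν : ℤ)),
        if α ≤ (ν : ℝ) / p ∧ (ν : ℝ) / p < β then (1 : ℝ) else 0 := by
  unfold primeRootPairCount
  push_cast
  refine sum_congr rfl fun p _ => ?_
  rw [← filter_filter, card_filter, Nat.cast_sum]
  simp only [Nat.cast_ite, Nat.cast_one, Nat.cast_zero]

/-- The total pair count as a double sum of `1`. [folklore] -/
theorem primeRootPairCount_zero_one_eq_sum_sum (f : ℤ[X]) (P : ℕ) :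
    (primeRootPairCount f 0 1 P : ℝ) = ∑ p ∈ Nat.primesLE P,
      ∑ _ν ∈ (range p).filter (fun ν : ℕ => (p : ℤ) ∣ f.eval (ν : ℤ)), (1 : ℝ) := by
  rw [primeRootPairCount_zero_one]
  push_cast
  refine sum_congr rfl fun p _ => ?_
  rw [← card_filter_dvd_eval_eq_polyRootCountMod]
  simp

/-! ### The exponential `e(t) = exp(2πit)` -/

/-- `|e(s) − e(t)| ≤ 2π |s − t|`. [folklore] -/
theorem norm_exp_two_pi_mul_I_sub_le (s t : ℝ) :
    ‖Complex.exp (2 * Real.pi * Complex.I * s) - Complex.exp (2 * Real.pi * Complex.I * t)‖ ≤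
      2 * Real.pi * |s - t| := by
  have h1 : Complex.exp (2 * Real.pi * Complex.I * s) - Complex.exp (2 * Real.pi * Complex.I * t) =
      Complex.exp (2 * Real.pi * Complex.I * t) *
        (Complex.exp (Complex.I * ((2 * Real.pi * (s - t) : ℝ) : ℂ)) - 1) := by
    rw [mul_sub, mul_one, ← Complex.exp_add]
    congr 1
    push_cast
    ring_nf
  rw [h1, norm_mul]
  have h2 : ‖Complex.exp (2 * Real.pi * Complex.I * t)‖ = 1 := by
    rw [show (2 * Real.pi * Complex.I * t : ℂ) = ((2 * Real.pi * t : ℝ) : ℂ) * Complex.I by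
      push_cast; ring]
    exact Complex.norm_exp_ofReal_mul_I _
  rw [h2, one_mul]
  refine Real.norm_exp_I_mul_ofReal_sub_one_le.trans ?_
  rw [Real.norm_eq_abs, abs_mul, abs_of_pos Real.two_pi_pos]

/-- `|e(t)| = 1`. [folklore] -/
theorem norm_exp_two_pi_mul_I (t : ℝ) : ‖Complex.exp (2 * Real.pi * Complex.I * t)‖ = 1 := by
  rw [show (2 * Real.pi * Complex.I * t : ℂ) = ((2 * Real.pi * t : ℝ) : ℂ) * Complex.I by
    push_cast; ring]
  exact Complex.norm_exp_ofReal_mul_I _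

/-- `∑_{k < K} e(hk/K) = 0` when `0 < |h| < K` (`e(h/K)` is a nontrivial `K`-th root of unity).
[folklore] -/
theorem sum_range_exp_two_pi_mul_I_eq_zero {h : ℤ} {K : ℕ} (hh : h ≠ 0) (hK : h.natAbs < K) :
    ∑ k ∈ range K, Complex.exp (2 * Real.pi * Complex.I * ((h * k / K : ℝ) : ℂ)) = 0 := by
  have hK0 : 0 < K := lt_of_le_of_lt (Nat.zero_le _) hK
  have hK0' : (K : ℂ) ≠ 0 := by exact_mod_cast hK0.ne'
  have hπ : (2 * Real.pi * Complex.I : ℂ) ≠ 0 := by simp [Real.pi_ne_zero, Complex.I_ne_zero]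
  set ζ : ℂ := Complex.exp (2 * Real.pi * Complex.I * (h / K : ℂ)) with hζ
  have hterm : ∀ k : ℕ,
      Complex.exp (2 * Real.pi * Complex.I * ((h * k / K : ℝ) : ℂ)) = ζ ^ k := by
    intro k
    rw [hζ, ← Complex.exp_nat_mul]
    congr 1
    push_cast
    ring
  simp_rw [hterm]
  have hζK : ζ ^ K = 1 := by
    rw [hζ, ← Complex.exp_nat_mul]
    have : (K : ℂ) * (2 * Real.pi * Complex.I * (h / K : ℂ)) = h * (2 * Real.pi * Complex.I) := by
      field_simp
    rw [this]
    exact Complex.exp_int_mul_two_pi_mul_I h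
  have hζ1 : ζ ≠ 1 := by
    intro h1
    rw [hζ, Complex.exp_eq_one_iff] at h1
    obtain ⟨n, hn⟩ := h1
    have h2 : (h : ℂ) = n * K := by
      have hn' : (h : ℂ) / K * (2 * Real.pi * Complex.I) = (n : ℂ) * (2 * Real.pi * Complex.I) := by
        rw [← hn]; ring
      have h3 := mul_right_cancel₀ hπ hn'
      field_simp at h3
      linear_combination h3
    have h3 : h = n * K := by exact_mod_cast h2
    have h4 : K ≤ h.natAbs := by
      rw [h3, Int.natAbs_mul, Int.natAbs_natCast]
      have hn0 : n ≠ 0 := by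
        rintro rfl
        simp [h3] at hh
      exact Nat.le_mul_of_pos_left K (Int.natAbs_pos.mpr hn0)
    omega
  rw [geom_sum_eq hζ1, hζK, sub_self, zero_div]

/-! ### Locating `ν/p` in one of `K` equal parts of `[0, 1)` -/

/-- For `ν` and `p > 0`, with `k = ⌊Kν/p⌋` (natural division): `k/K ≤ ν/p < (k+1)/K`.
[folklore] -/
theorem div_mem_part {K p : ℕ} (hK : 0 < K) (hp : 0 < p) (ν : ℕ) :
    ((K * ν / p : ℕ) : ℝ) / K ≤ (ν : ℝ) / p ∧ (ν : ℝ) / p < ((K * ν / p : ℕ) + 1 : ℝ) / K := by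
  have hK' : (0 : ℝ) < K := by exact_mod_cast hK
  have hp' : (0 : ℝ) < p := by exact_mod_cast hp
  have hdm := Nat.div_add_mod (K * ν) p
  have hml := Nat.mod_lt (K * ν) hp
  set q := K * ν / p
  set r := K * ν % p
  have hq : (p : ℝ) * q + r = K * ν := by exact_mod_cast hdm
  have hr0 : (0 : ℝ) ≤ r := by positivity
  have hrp : (r : ℝ) < p := by exact_mod_cast hml
  constructor
  · rw [div_le_div_iff₀ hK' hp']
    nlinarith
  · rw [div_lt_div_iff₀ hp' hK']
    nlinarith

/-- The part containing `ν/p` is unique: if `k/K ≤ ν/p < (k+1)/K` then `k = ⌊Kν/p⌋`.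
[folklore] -/
theorem eq_div_of_mem_part {K p : ℕ} (hK : 0 < K) (hp : 0 < p) {ν k : ℕ}
    (hk : (k : ℝ) / K ≤ (ν : ℝ) / p ∧ (ν : ℝ) / p < ((k : ℝ) + 1) / K) : k = K * ν / p := by
  have hK' : (0 : ℝ) < K := by exact_mod_cast hK
  obtain ⟨h1, h2⟩ := div_mem_part hK hp ν
  set q := K * ν / p
  have h3 : (k : ℝ) / K < ((q : ℝ) + 1) / K := hk.1.trans_lt h2
  have h4 : (q : ℝ) / K < ((k : ℝ) + 1) / K := h1.trans_lt hk.2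
  rw [div_lt_div_iff_of_pos_right hK'] at h3 h4
  have h5 : k < q + 1 := by exact_mod_cast h3
  have h6 : q < k + 1 := by exact_mod_cast h4
  omega

/-- For `ν < p`, `⌊Kν/p⌋ < K`. [folklore] -/
theorem div_lt_of_lt {K p ν : ℕ} (hν : ν < p) : K * ν / p < K ⊔ 1 := by
  rcases Nat.eq_zero_or_pos K with rfl | hK
  · simp
  · have hp : 0 < p := lt_of_le_of_lt (Nat.zero_le _) hν
    rw [Nat.div_lt_iff_lt_mul hp]
    calc K * ν < K * p := Nat.mul_lt_mul_of_pos_left hν hK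
      _ ≤ (K ⊔ 1) * p := Nat.mul_le_mul_right _ le_sup_left

/-- Summing an indicator-weighted function over the `K` parts picks out the part of `ν/p`.
[folklore] -/
theorem sum_range_ite_mem_part {K p ν : ℕ} (hK : 0 < K) (hν : ν < p) (F : ℕ → ℂ) :
    ∑ k ∈ range K,
        (if (k : ℝ) / K ≤ (ν : ℝ) / p ∧ (ν : ℝ) / p < ((k : ℝ) + 1) / K then F k else 0) =
      F (K * ν / p) := by
  have hp : 0 < p := lt_of_le_of_lt (Nat.zero_le _) hν
  have hqK : K * ν / p < K := by
    have := div_lt_of_lt (K := K) hν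
    rwa [sup_eq_left.2 (Nat.one_le_of_lt hK)] at this
  rw [sum_eq_single_of_mem (K * ν / p) (mem_range.2 hqK)]
  · rw [if_pos]
    have := div_mem_part hK hp ν
    exact_mod_cast this
  · intro k _ hk
    rw [if_neg]
    intro hmem
    exact hk (eq_div_of_mem_part hK hp hmem)

/-! ### The main estimate -/

/-- **Block decomposition of the Weyl sum.**  For `K > 0` and every `P`,
`‖∑_{p ≤ P} S_f(h,p) − ∑_{k<K} e(hk/K) · #{pairs with ν/p ∈ [k/K,(k+1)/K)}‖ ≤ (2π|h|/K) · #{all pairs}`.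
[folklore] -/
theorem norm_sum_polyRootWeylSum_sub_sum_parts_le (f : ℤ[X]) (h : ℤ) {K : ℕ} (hK : 0 < K)
    (P : ℕ) :
    ‖∑ p ∈ Nat.primesLE P, polyRootWeylSum f p h -
        ∑ k ∈ range K, Complex.exp (2 * Real.pi * Complex.I * ((h * k / K : ℝ) : ℂ)) *
          (primeRootPairCount f ((k : ℝ) / K) (((k : ℝ) + 1) / K) P : ℝ)‖ ≤
      2 * Real.pi * |(h : ℝ)| / K * primeRootPairCount f 0 1 P := by
  have hK' : (0 : ℝ) < K := by exact_mod_cast hK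
  -- rewrite the middle sum as a double sum over the pairs
  have hmid : ∑ k ∈ range K, Complex.exp (2 * Real.pi * Complex.I * ((h * k / K : ℝ) : ℂ)) *
        (primeRootPairCount f ((k : ℝ) / K) (((k : ℝ) + 1) / K) P : ℝ) =
      ∑ p ∈ Nat.primesLE P, ∑ ν ∈ (range p).filter (fun ν : ℕ => (p : ℤ) ∣ f.eval (ν : ℤ)),
        Complex.exp (2 * Real.pi * Complex.I * ((h * (K * ν / p : ℕ) / K : ℝ) : ℂ)) := by
    have h1 : ∀ k ∈ range K,
        Complex.exp (2 * Real.pi * Complex.I * ((h * k / K : ℝ) : ℂ)) *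
          ((primeRootPairCount f ((k : ℝ) / K) (((k : ℝ) + 1) / K) P : ℝ) : ℂ) =
        ∑ p ∈ Nat.primesLE P, ∑ ν ∈ (range p).filter (fun ν : ℕ => (p : ℤ) ∣ f.eval (ν : ℤ)),
          (if (k : ℝ) / K ≤ (ν : ℝ) / p ∧ (ν : ℝ) / p < ((k : ℝ) + 1) / K then
            Complex.exp (2 * Real.pi * Complex.I * ((h * k / K : ℝ) : ℂ)) else 0) := by
      intro k _
      rw [primeRootPairCount_eq_sum_sum]
      push_cast
      rw [mul_sum]
      refine sum_congr rfl fun p _ => ?_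
      rw [mul_sum]
      refine sum_congr rfl fun ν _ => ?_
      split_ifs <;> simp
    rw [sum_congr rfl h1, sum_comm]
    refine sum_congr rfl fun p hp => ?_
    rw [sum_comm]
    refine sum_congr rfl fun ν hν => ?_
    have hνp : ν < p := mem_range.1 (mem_filter.1 hν).1
    exact sum_range_ite_mem_part hK hνp _
  rw [hmid]
  simp only [polyRootWeylSum_def]
  rw [← sum_sub_distrib]
  have htot := primeRootPairCount_zero_one_eq_sum_sum f P
  rw [htot, mul_sum]
  refine (norm_sum_le _ _).trans (sum_le_sum fun p hp => ?_)
  rw [← sum_sub_distrib, mul_sum]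
  refine (norm_sum_le _ _).trans (sum_le_sum fun ν hν => ?_)
  rw [mul_one]
  have hp0 : 0 < p := (Nat.mem_primesLE.mp hp).2.pos
  have hp0' : (0 : ℝ) < p := by exact_mod_cast hp0
  obtain ⟨h1, h2⟩ := div_mem_part hK hp0 ν
  set q : ℕ := K * ν / p with hq
  have hcast : (2 * Real.pi * Complex.I * (h * ν / p : ℂ) : ℂ) =
      2 * Real.pi * Complex.I * ((h * ν / p : ℝ) : ℂ) := by push_cast; ring
  rw [hcast]
  refine (norm_exp_two_pi_mul_I_sub_le _ _).trans ?_
  have hdiff : (h : ℝ) * ν / p - h * q / K = h * ((ν : ℝ) / p - q / K) := by ring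
  have h3 : ((q : ℝ) + 1) / K = q / K + 1 / K := by ring
  have hin : |(ν : ℝ) / p - q / K| ≤ 1 / K := by
    rw [abs_of_nonneg (by linarith)]
    linarith
  calc 2 * Real.pi * |(h : ℝ) * ν / p - h * q / K|
      = 2 * Real.pi * (|(h : ℝ)| * |(ν : ℝ) / p - q / K|) := by rw [hdiff, abs_mul]
    _ ≤ 2 * Real.pi * (|(h : ℝ)| * (1 / K)) := by gcongr
    _ = 2 * Real.pi * |(h : ℝ)| / K := by ring

/-- **Uniform distribution in counting form implies the Weyl-sum form** (the elementary half
of Weyl's criterion, for the fractions `ν/p` of the roots of `f` to prime moduli).  Let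
`g : ℕ → ℝ` be eventually nonnegative.  If for all `0 ≤ α < β ≤ 1` the number of pairs `(p, ν)`
(`p ≤ P` prime, `f(ν) ≡ 0 (mod p)`, `0 ≤ ν < p`) with `α ≤ ν/p < β` is `(β − α) g(P) + o(g(P))`,
and the total number of pairs is `O(g(P))`, then for every integer `h ≠ 0`,
`∑_{p ≤ P} ∑_{ν} e(hν/p) = o(g(P))`. [folklore] -/
theorem isLittleO_sum_polyRootWeylSum_of_counting {f : ℤ[X]} {g : ℕ → ℝ}
    (hud : ∀ α β : ℝ, 0 ≤ α → α < β → β ≤ 1 →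
      (fun P : ℕ => (primeRootPairCount f α β P : ℝ) - (β - α) * g P) =o[atTop] g)
    (hN : (fun P : ℕ => (primeRootPairCount f 0 1 P : ℝ)) =O[atTop] g)
    {h : ℤ} (hh : h ≠ 0) :
    (fun P : ℕ => ∑ p ∈ Nat.primesLE P, polyRootWeylSum f p h) =o[atTop] g := by
  rw [isLittleO_iff]
  intro ε hε
  obtain ⟨C, hC0, hC⟩ := hN.exists_pos
  rw [IsBigOWith] at hC
  -- choose the number of parts
  obtain ⟨K, hK⟩ := exists_nat_gt (max (h.natAbs : ℝ) (8 * Real.pi * |(h : ℝ)| * C / ε))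
  have hKh : h.natAbs < K := by
    have := (le_max_left _ _).trans_lt hK
    exact_mod_cast this
  have hK0 : 0 < K := lt_of_le_of_lt (Nat.zero_le _) hKh
  have hK0' : (0 : ℝ) < K := by exact_mod_cast hK0
  have hKε : 2 * Real.pi * |(h : ℝ)| / K * C ≤ ε / 4 := by
    have h1 : 8 * Real.pi * |(h : ℝ)| * C / ε < K := (le_max_right _ _).trans_lt hK
    rw [div_lt_iff₀ hε] at h1
    rw [div_mul_eq_mul_div, div_le_iff₀ hK0']
    linarith
  -- each part carries `g/K + o(g)` points
  have hparts : ∀ᶠ P in atTop, ∀ k ∈ range K,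
      ‖(primeRootPairCount f ((k : ℝ) / K) (((k : ℝ) + 1) / K) P : ℝ) -
        (((k : ℝ) + 1) / K - (k : ℝ) / K) * g P‖ ≤ ε / (2 * K) * ‖g P‖ := by
    rw [eventually_all_finset]
    intro k hk
    have hk' : k + 1 ≤ K := mem_range.1 hk
    refine (hud ((k : ℝ) / K) (((k : ℝ) + 1) / K) (by positivity) ?_ ?_).bound (by positivity)
    · exact div_lt_div_of_pos_right (by linarith) hK0'
    · rw [div_le_one hK0']
      exact_mod_cast hk'
  filter_upwards [hparts, hC] with P hP hCP
  have hroots := sum_range_exp_two_pi_mul_I_eq_zero hh hKh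
  set E : ℕ → ℂ := fun k => Complex.exp (2 * Real.pi * Complex.I * ((h * k / K : ℝ) : ℂ)) with hE
  set cnt : ℕ → ℝ := fun k => (primeRootPairCount f ((k : ℝ) / K) (((k : ℝ) + 1) / K) P : ℝ)
    with hcnt
  have hdec := norm_sum_polyRootWeylSum_sub_sum_parts_le f h hK0 P
  -- the main term vanishes: `∑_k e(hk/K) cnt_k = ∑_k e(hk/K) (cnt_k − g/K)`
  have hmain : ∑ k ∈ range K, E k * (cnt k : ℂ) =
      ∑ k ∈ range K, E k * ((cnt k - (((k : ℝ) + 1) / K - (k : ℝ) / K) * g P : ℝ) : ℂ) := by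
    have h1 : ∀ k ∈ range K, E k * ((cnt k - (((k : ℝ) + 1) / K - (k : ℝ) / K) * g P : ℝ) : ℂ) =
        E k * (cnt k : ℂ) - E k * ((g P / K : ℝ) : ℂ) := by
      intro k _
      push_cast
      ring
    rw [sum_congr rfl h1, sum_sub_distrib, ← sum_mul, hroots, zero_mul, sub_zero]
  have hmainle : ‖∑ k ∈ range K, E k * (cnt k : ℂ)‖ ≤ ε / 2 * ‖g P‖ := by
    rw [hmain]
    refine (norm_sum_le _ _).trans ?_
    calc ∑ k ∈ range K, ‖E k * ((cnt k - (((k : ℝ) + 1) / K - (k : ℝ) / K) * g P : ℝ) : ℂ)‖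
        ≤ ∑ _k ∈ range K, ε / (2 * K) * ‖g P‖ := by
          refine sum_le_sum fun k hk => ?_
          rw [norm_mul, hE, norm_exp_two_pi_mul_I, one_mul, Complex.norm_real]
          exact hP k hk
      _ = ε / 2 * ‖g P‖ := by
          rw [sum_const, card_range, nsmul_eq_mul]
          field_simp
  have hNP : (primeRootPairCount f 0 1 P : ℝ) ≤ C * ‖g P‖ := by
    have := hCP
    rwa [Real.norm_natCast] at this
  calc ‖∑ p ∈ Nat.primesLE P, polyRootWeylSum f p h‖
      ≤ ‖∑ p ∈ Nat.primesLE P, polyRootWeylSum f p h - ∑ k ∈ range K, E k * (cnt k : ℂ)‖ +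
          ‖∑ k ∈ range K, E k * (cnt k : ℂ)‖ := norm_le_norm_sub_add _ _
    _ ≤ 2 * Real.pi * |(h : ℝ)| / K * primeRootPairCount f 0 1 P + ε / 2 * ‖g P‖ :=
          add_le_add hdec hmainle
    _ ≤ 2 * Real.pi * |(h : ℝ)| / K * (C * ‖g P‖) + ε / 2 * ‖g P‖ := by
          gcongr
    _ = (2 * Real.pi * |(h : ℝ)| / K * C) * ‖g P‖ + ε / 2 * ‖g P‖ := by ring
    _ ≤ ε / 4 * ‖g P‖ + ε / 2 * ‖g P‖ := by gcongr
    _ ≤ ε * ‖g P‖ := by nlinarith [norm_nonneg (g P)]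

/-! ### From the count on `[0, 1)` to a `O(g)` bound -/

/-- From u.d. with normaliser `g`: if the count on `[0,1)` is `g + o(g)` then it is `O(g)`.
[folklore] -/
theorem isBigO_primeRootPairCount_of_counting {f : ℤ[X]} {g : ℕ → ℝ}
    (h01 : (fun P : ℕ => (primeRootPairCount f 0 1 P : ℝ) - (1 - 0) * g P) =o[atTop] g) :
    (fun P : ℕ => (primeRootPairCount f 0 1 P : ℝ)) =O[atTop] g := by
  have h1 : (fun P : ℕ => (1 - 0 : ℝ) * g P) =O[atTop] g :=
    (isBigO_refl g atTop).const_mul_left _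
  have := h01.isBigO.add h1
  simpa only [sub_add_cancel] using this

section WeylToCounting

open MeasureTheory AddCircle

/-! ### The other half of Weyl's criterion: Weyl-sum form ⇒ counting form

Conversely, if `∑_{p ≤ P} S_f(h, p) = o(g(P))` for every `h ≠ 0` and the number of fractions is
`N(P) = g(P) + o(g(P))`, then `#{ν/p ∈ [α, β)} = (β − α) g(P) + o(g(P))` for all
`0 ≤ α < β ≤ 1`.  Proof (Weyl): test functions on `ℝ/ℤ`; the characters `e(hx)` satisfy the
claim by hypothesis, hence so does their span, hence (uniform approximation, Fejér/Weierstrass: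
Mathlib's `span_fourier_closure_eq_top`) every continuous function, and finally indicators of
arcs, squeezed between two Urysohn functions whose integrals differ by at most `4δ`. -/

/-- The sum of a test function `F : ℝ/ℤ → ℂ` over the fractions `ν/p`, `p ≤ P` prime,
`f(ν) ≡ 0 (mod p)`, `0 ≤ ν < p`. [folklore] -/
def rootFractionSum (f : ℤ[X]) (F : UnitAddCircle → ℂ) (P : ℕ) : ℂ :=
  ∑ p ∈ Nat.primesLE P, ∑ ν ∈ (range p).filter (fun ν : ℕ => (p : ℤ) ∣ f.eval (ν : ℤ)),
    F ((((ν : ℝ) / p : ℝ)) : UnitAddCircle)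

/-- Unfolding `rootFractionSum`. [folklore] -/
theorem rootFractionSum_def (f : ℤ[X]) (F : UnitAddCircle → ℂ) (P : ℕ) :
    rootFractionSum f F P = ∑ p ∈ Nat.primesLE P,
      ∑ ν ∈ (range p).filter (fun ν : ℕ => (p : ℤ) ∣ f.eval (ν : ℤ)),
        F ((((ν : ℝ) / p : ℝ)) : UnitAddCircle) :=
  rfl

/-- On the character `e(nx)` the test sum is the Weyl sum `∑_{p ≤ P} S_f(n, p)`. [folklore] -/
theorem rootFractionSum_fourier (f : ℤ[X]) (n : ℤ) (P : ℕ) :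
    rootFractionSum f (fourier n) P = ∑ p ∈ Nat.primesLE P, polyRootWeylSum f p n := by
  unfold rootFractionSum
  refine sum_congr rfl fun p _ => ?_
  rw [polyRootWeylSum_def]
  refine sum_congr rfl fun ν _ => ?_
  rw [fourier_coe_apply]
  congr 1
  push_cast
  ring

/-- On the constant `1` the test sum is the number of fractions `N(P)`. [folklore] -/
theorem rootFractionSum_one (f : ℤ[X]) (P : ℕ) :
    rootFractionSum f (fun _ => 1) P = (primeRootPairCount f 0 1 P : ℂ) := by
  have h := primeRootPairCount_zero_one_eq_sum_sum f P
  have h' : ((primeRootPairCount f 0 1 P : ℝ) : ℂ) = ∑ p ∈ Nat.primesLE P,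
      ∑ _ν ∈ (range p).filter (fun ν : ℕ => (p : ℤ) ∣ f.eval (ν : ℤ)), (1 : ℂ) := by
    rw [h]
    push_cast
    rfl
  rw [rootFractionSum]
  exact_mod_cast h'.symm

/-- The test sum is additive in the test function. [folklore] -/
theorem rootFractionSum_add (f : ℤ[X]) (F G : UnitAddCircle → ℂ) (P : ℕ) :
    rootFractionSum f (fun x => F x + G x) P = rootFractionSum f F P + rootFractionSum f G P := by
  simp only [rootFractionSum, sum_add_distrib]

/-- The test sum is subtractive in the test function. [folklore] -/
theorem rootFractionSum_sub (f : ℤ[X]) (F G : UnitAddCircle → ℂ) (P : ℕ) :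
    rootFractionSum f (fun x => F x - G x) P = rootFractionSum f F P - rootFractionSum f G P := by
  simp only [rootFractionSum, sum_sub_distrib]

/-- The test sum is homogeneous in the test function. [folklore] -/
theorem rootFractionSum_smul (f : ℤ[X]) (c : ℂ) (F : UnitAddCircle → ℂ) (P : ℕ) :
    rootFractionSum f (fun x => c * F x) P = c * rootFractionSum f F P := by
  simp only [rootFractionSum, mul_sum]

/-- A bounded test function has test sum at most `B · N(P)`. [folklore] -/
theorem norm_rootFractionSum_le (f : ℤ[X]) {F : UnitAddCircle → ℂ} {B : ℝ} (hB : ∀ x, ‖F x‖ ≤ B)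
    (P : ℕ) : ‖rootFractionSum f F P‖ ≤ B * primeRootPairCount f 0 1 P := by
  rw [primeRootPairCount_zero_one_eq_sum_sum, mul_sum]
  refine (norm_sum_le _ _).trans (sum_le_sum fun p _ => ?_)
  rw [mul_sum]
  refine (norm_sum_le _ _).trans (sum_le_sum fun ν _ => ?_)
  rw [mul_one]
  exact hB _

/-- `∫ e(nx) dx = [n = 0]` on `ℝ/ℤ`. [folklore] -/
theorem integral_fourier_haarAddCircle (n : ℤ) :
    ∫ x : UnitAddCircle, fourier n x ∂haarAddCircle = if n = 0 then 1 else 0 := by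
  have h := congrFun (fourierCoeff_fourier (T := 1) n) 0
  rw [fourierCoeff, Pi.single_apply] at h
  simp only [neg_zero, fourier_zero, one_smul] at h
  rw [h]
  simp only [eq_comm]

/-- The Haar probability measure of `ℝ/ℤ` is Mathlib's `volume`. [folklore] -/
theorem volume_eq_haarAddCircle : (volume : Measure UnitAddCircle) = haarAddCircle := by
  rw [AddCircle.volume_eq_smul_haarAddCircle, ENNReal.ofReal_one, one_smul]

/-- The measure of an arc: `|closedBall x ε| = min(1, 2ε)`. [folklore] -/
theorem haarAddCircle_real_closedBall (x : UnitAddCircle) {ε : ℝ} (hε : 0 ≤ ε) :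
    (haarAddCircle : Measure UnitAddCircle).real (Metric.closedBall x ε) = min 1 (2 * ε) := by
  rw [← volume_eq_haarAddCircle, Measure.real, AddCircle.volume_closedBall, ENNReal.toReal_ofReal]
  exact le_min zero_le_one (by linarith)

/-- A continuous function on `ℝ/ℤ` is integrable. [folklore] -/
theorem integrable_continuousMap_addCircle (F : C(UnitAddCircle, ℂ)) :
    Integrable F (haarAddCircle : Measure UnitAddCircle) :=
  F.continuous.integrable_of_hasCompactSupport (HasCompactSupport.of_compactSpace F)

/-- A real continuous function on `ℝ/ℤ` is integrable. [folklore] -/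
theorem integrable_continuousMap_addCircle_real (F : C(UnitAddCircle, ℝ)) :
    Integrable F (haarAddCircle : Measure UnitAddCircle) :=
  F.continuous.integrable_of_hasCompactSupport (HasCompactSupport.of_compactSpace F)

variable {f : ℤ[X]} {g : ℕ → ℝ}

/-- **The Weyl property of a test function** `F` with respect to the normaliser `g`:
`∑_{(p, ν)} F(ν/p) = (∫ F) g(P) + o(g(P))`. [folklore] -/
def IsWeylGood (f : ℤ[X]) (g : ℕ → ℝ) (F : C(UnitAddCircle, ℂ)) : Prop :=
  (fun P : ℕ => rootFractionSum f F P - (∫ x, F x ∂haarAddCircle) * g P) =o[atTop] g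

/-- The characters `e(nx)` have the Weyl property, by hypothesis. [folklore] -/
theorem isWeylGood_fourier
    (hW : ∀ h : ℤ, h ≠ 0 → (fun P : ℕ => ∑ p ∈ Nat.primesLE P, polyRootWeylSum f p h) =o[atTop] g)
    (hN : (fun P : ℕ => (primeRootPairCount f 0 1 P : ℝ) - g P) =o[atTop] g) (n : ℤ) :
    IsWeylGood f g (fourier n) := by
  unfold IsWeylGood
  simp only [rootFractionSum_fourier, integral_fourier_haarAddCircle]
  rcases eq_or_ne n 0 with rfl | hn
  · simp only [if_true, one_mul]
    refine IsLittleO.of_norm_left ?_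
    have h1 : (fun P : ℕ => ‖∑ p ∈ Nat.primesLE P, polyRootWeylSum f p 0 - (g P : ℂ)‖) =
        fun P : ℕ => ‖(primeRootPairCount f 0 1 P : ℝ) - g P‖ := by
      funext P
      rw [← rootFractionSum_fourier, show (fourier 0 : UnitAddCircle → ℂ) = fun _ => 1 from
        funext fun x => fourier_zero, rootFractionSum_one]
      rw [show ((primeRootPairCount f 0 1 P : ℕ) : ℂ) - (g P : ℂ) =
        (((primeRootPairCount f 0 1 P : ℝ) - g P : ℝ) : ℂ) by push_cast; ring, Complex.norm_real]
    rw [h1]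
    exact hN.norm_left
  · simp only [hn, if_false, zero_mul, sub_zero]
    exact hW n hn

/-- The test functions with the Weyl property form a subspace. [folklore] -/
def weylGoodSubmodule (f : ℤ[X]) (g : ℕ → ℝ) : Submodule ℂ C(UnitAddCircle, ℂ) where
  carrier := {F | IsWeylGood f g F}
  zero_mem' := by
    show (fun P : ℕ => rootFractionSum f (0 : C(UnitAddCircle, ℂ)) P -
      (∫ x, (0 : C(UnitAddCircle, ℂ)) x ∂haarAddCircle) * g P) =o[atTop] g
    simp only [ContinuousMap.coe_zero, Pi.zero_apply, integral_zero, zero_mul, sub_zero,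
      rootFractionSum, sum_const_zero]
    exact isLittleO_zero _ _
  add_mem' := by
    intro F G hF hG
    show (fun P : ℕ => rootFractionSum f (F + G) P -
      (∫ x, (F + G) x ∂haarAddCircle) * g P) =o[atTop] g
    have h := hF.add hG
    refine h.congr' (Eventually.of_forall fun P => ?_) EventuallyEq.rfl
    simp only [ContinuousMap.coe_add, Pi.add_apply]
    rw [integral_add (integrable_continuousMap_addCircle F) (integrable_continuousMap_addCircle G),
      show ((⇑F + ⇑G : UnitAddCircle → ℂ)) = fun x => F x + G x from rfl, rootFractionSum_add]
    ring
  smul_mem' := by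
    intro c F hF
    show (fun P : ℕ => rootFractionSum f (c • F) P -
      (∫ x, (c • F) x ∂haarAddCircle) * g P) =o[atTop] g
    have h := hF.const_mul_left c
    refine h.congr' (Eventually.of_forall fun P => ?_) EventuallyEq.rfl
    simp only [ContinuousMap.coe_smul, Pi.smul_apply, smul_eq_mul]
    rw [integral_const_mul, show ((c • ⇑F : UnitAddCircle → ℂ)) = fun x => c * F x from rfl,
      rootFractionSum_smul]
    ring

/-- Trigonometric polynomials have the Weyl property. [folklore] -/
theorem isWeylGood_of_mem_span
    (hW : ∀ h : ℤ, h ≠ 0 → (fun P : ℕ => ∑ p ∈ Nat.primesLE P, polyRootWeylSum f p h) =o[atTop] g)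
    (hN : (fun P : ℕ => (primeRootPairCount f 0 1 P : ℝ) - g P) =o[atTop] g)
    {F : C(UnitAddCircle, ℂ)} (hF : F ∈ Submodule.span ℂ (Set.range (fourier (T := 1)))) :
    IsWeylGood f g F := by
  have hle : Submodule.span ℂ (Set.range (fourier (T := 1))) ≤ weylGoodSubmodule f g := by
    rw [Submodule.span_le]
    rintro _ ⟨n, rfl⟩
    exact isWeylGood_fourier hW hN n
  exact hle hF

/-- **Weyl's criterion, the test-function step**: under the Weyl-sum hypothesis every
continuous `F : ℝ/ℤ → ℂ` satisfies `∑_{(p, ν)} F(ν/p) = (∫ F) g(P) + o(g(P))`. [folklore] -/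
theorem isWeylGood_of_weylSums
    (hW : ∀ h : ℤ, h ≠ 0 → (fun P : ℕ => ∑ p ∈ Nat.primesLE P, polyRootWeylSum f p h) =o[atTop] g)
    (hN : (fun P : ℕ => (primeRootPairCount f 0 1 P : ℝ) - g P) =o[atTop] g)
    (F : C(UnitAddCircle, ℂ)) : IsWeylGood f g F := by
  have hmem : F ∈ closure ((Submodule.span ℂ (Set.range (fourier (T := 1)))) :
      Set C(UnitAddCircle, ℂ)) := by
    rw [← Submodule.topologicalClosure_coe, span_fourier_closure_eq_top]
    trivial
  obtain ⟨C, hC0, hC⟩ := (isBigO_primeRootPairCount_of_counting (g := g)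
    (by simpa only [sub_zero, one_mul] using hN)).exists_pos
  rw [IsWeylGood, isLittleO_iff]
  intro c hc
  set ε : ℝ := c / (2 * (C + 1)) with hε
  have hε0 : 0 < ε := by positivity
  obtain ⟨T, hT, hFT⟩ := Metric.mem_closure_iff.1 hmem ε hε0
  have hgoodT := isWeylGood_of_mem_span hW hN hT
  rw [IsWeylGood, isLittleO_iff] at hgoodT
  filter_upwards [hgoodT (half_pos hc), hC.bound] with P hP hCP
  rw [Real.norm_natCast] at hCP
  have hpt : ∀ x, ‖F x - T x‖ ≤ ε := fun x => by
    have h1 := ContinuousMap.dist_apply_le_dist (f := F) (g := T) x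
    rw [dist_eq_norm] at h1
    exact h1.trans hFT.le
  have hsum : ‖rootFractionSum f F P - rootFractionSum f T P‖ ≤ ε * primeRootPairCount f 0 1 P := by
    rw [← rootFractionSum_sub]
    exact norm_rootFractionSum_le f hpt P
  have hint : ‖(∫ x, F x ∂haarAddCircle) - ∫ x, T x ∂haarAddCircle‖ ≤ ε := by
    rw [← integral_sub (integrable_continuousMap_addCircle F) (integrable_continuousMap_addCircle T)]
    have h1 := norm_integral_le_of_norm_le_const (μ := (haarAddCircle : Measure UnitAddCircle))
      (f := fun x => F x - T x) (Eventually.of_forall hpt)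
    simpa using h1
  have hkey : rootFractionSum f F P - (∫ x, F x ∂haarAddCircle) * g P =
      (rootFractionSum f F P - rootFractionSum f T P) +
        (rootFractionSum f T P - (∫ x, T x ∂haarAddCircle) * g P) +
          ((∫ x, T x ∂haarAddCircle) - ∫ x, F x ∂haarAddCircle) * g P := by ring
  rw [hkey]
  have hg : ‖(g P : ℂ)‖ = ‖g P‖ := Complex.norm_real _
  calc ‖(rootFractionSum f F P - rootFractionSum f T P) +
        (rootFractionSum f T P - (∫ x, T x ∂haarAddCircle) * g P) +
          ((∫ x, T x ∂haarAddCircle) - ∫ x, F x ∂haarAddCircle) * g P‖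
      ≤ ‖rootFractionSum f F P - rootFractionSum f T P‖ +
          ‖rootFractionSum f T P - (∫ x, T x ∂haarAddCircle) * g P‖ +
            ‖((∫ x, T x ∂haarAddCircle) - ∫ x, F x ∂haarAddCircle) * (g P : ℂ)‖ :=
        norm_add₃_le
    _ ≤ ε * primeRootPairCount f 0 1 P + c / 2 * ‖g P‖ + ε * ‖g P‖ := by
        refine add_le_add (add_le_add hsum hP) ?_
        rw [norm_mul, hg, norm_sub_rev]
        exact mul_le_mul_of_nonneg_right hint (norm_nonneg _)
    _ ≤ ε * (C * ‖g P‖) + c / 2 * ‖g P‖ + ε * ‖g P‖ := by gcongr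
    _ = (ε * (C + 1) + c / 2) * ‖g P‖ := by ring
    _ = c * ‖g P‖ := by
        rw [hε]
        field_simp
        ring

/-! #### From test functions to arcs -/

/-- A fraction in `[α, β)` lands in the closed arc of centre `(α + β)/2` and radius `(β − α)/2`.
[folklore] -/
theorem coe_mem_closedBall_of_mem_Ico {α β y : ℝ} (hy : α ≤ y ∧ y < β) :
    ((y : ℝ) : UnitAddCircle) ∈
      Metric.closedBall ((((α + β) / 2 : ℝ)) : UnitAddCircle) ((β - α) / 2) := by
  have h : y ∈ ((↑) : ℝ → UnitAddCircle) ⁻¹'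
      Metric.closedBall ((((α + β) / 2 : ℝ)) : UnitAddCircle) ((β - α) / 2) := by
    rw [AddCircle.coe_real_preimage_closedBall_eq_iUnion]
    refine Set.mem_iUnion.2 ⟨0, ?_⟩
    rw [zero_smul, add_zero, Metric.mem_closedBall, Real.dist_eq, abs_le]
    constructor <;> linarith [hy.1, hy.2]
  exact h

/-- Conversely, for `0 ≤ α`, `β ≤ 1` and `y ∈ [0, 1)`: if `y (mod 1)` lies in the OPEN arc of
centre `(α + β)/2` and radius `(β − α)/2` then `α < y < β` (no wrap-around). [folklore] -/
theorem mem_Ioo_of_coe_mem_ball {α β y : ℝ} (h0 : 0 ≤ α) (h1 : β ≤ 1) (hy0 : 0 ≤ y) (hy1 : y < 1)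
    (hy : ((y : ℝ) : UnitAddCircle) ∈
      Metric.ball ((((α + β) / 2 : ℝ)) : UnitAddCircle) ((β - α) / 2)) :
    α < y ∧ y < β := by
  set ε : ℝ := dist ((y : ℝ) : UnitAddCircle) ((((α + β) / 2 : ℝ)) : UnitAddCircle) with hεdef
  have hε : ε < (β - α) / 2 := Metric.mem_ball.1 hy
  have hmem : y ∈ ((↑) : ℝ → UnitAddCircle) ⁻¹'
      Metric.closedBall ((((α + β) / 2 : ℝ)) : UnitAddCircle) ε :=
    Metric.mem_closedBall.2 le_rfl
  rw [AddCircle.coe_real_preimage_closedBall_eq_iUnion] at hmem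
  obtain ⟨z, hz⟩ := Set.mem_iUnion.1 hmem
  rw [Metric.mem_closedBall, Real.dist_eq, zsmul_eq_mul, mul_one, abs_le] at hz
  rcases lt_trichotomy z 0 with hneg | hzero | hpos
  · exfalso
    have hz' : (z : ℝ) ≤ -1 := by
      have : z ≤ -1 := by omega
      exact_mod_cast this
    linarith [hz.1, hz.2]
  · subst hzero
    simp only [Int.cast_zero, add_zero] at hz
    constructor <;> linarith [hz.1, hz.2]
  · exfalso
    have hz' : (1 : ℝ) ≤ z := by exact_mod_cast hpos
    linarith [hz.1, hz.2]

/-- Nonnegativity of the normaliser, eventually, from `N = g + o(g)` and `N ≥ 0`. [folklore] -/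
theorem eventually_nonneg_of_count
    (hN : (fun P : ℕ => (primeRootPairCount f 0 1 P : ℝ) - g P) =o[atTop] g) :
    ∀ᶠ P in atTop, 0 ≤ g P := by
  filter_upwards [hN.bound (show (0 : ℝ) < 1 / 2 by norm_num)] with P hP
  by_contra hneg
  push Not at hneg
  rw [Real.norm_eq_abs, Real.norm_eq_abs, abs_of_neg hneg] at hP
  have h0 : (0 : ℝ) ≤ primeRootPairCount f 0 1 P := Nat.cast_nonneg _
  have h1 : |(primeRootPairCount f 0 1 P : ℝ) - g P| ≥ -g P := by
    rw [abs_of_nonneg (by linarith)]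
    linarith
  linarith

/-- Lifting a real continuous function on `ℝ/ℤ` to a complex test function. [folklore] -/
def toComplexTest (G : C(UnitAddCircle, ℝ)) : C(UnitAddCircle, ℂ) :=
  ⟨fun x => (G x : ℂ), Complex.continuous_ofReal.comp G.continuous⟩

/-- Unfolding `toComplexTest`. [folklore] -/
@[simp] theorem toComplexTest_apply (G : C(UnitAddCircle, ℝ)) (x : UnitAddCircle) :
    toComplexTest G x = (G x : ℂ) := rfl

/-- The Weyl property of a REAL test function, in real terms. [folklore] -/
theorem abs_sub_le_of_isWeylGood (G : C(UnitAddCircle, ℝ)) (hG : IsWeylGood f g (toComplexTest G))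
    {c : ℝ} (hc : 0 < c) :
    ∀ᶠ P in atTop, |∑ p ∈ Nat.primesLE P,
        ∑ ν ∈ (range p).filter (fun ν : ℕ => (p : ℤ) ∣ f.eval (ν : ℤ)),
          G ((((ν : ℝ) / p : ℝ)) : UnitAddCircle) -
        (∫ x, G x ∂haarAddCircle) * g P| ≤ c * ‖g P‖ := by
  rw [IsWeylGood, isLittleO_iff] at hG
  filter_upwards [hG hc] with P hP
  have h1 : rootFractionSum f (toComplexTest G) P -
      (∫ x, (toComplexTest G) x ∂haarAddCircle) * g P =
      ((∑ p ∈ Nat.primesLE P, ∑ ν ∈ (range p).filter (fun ν : ℕ => (p : ℤ) ∣ f.eval (ν : ℤ)),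
          G ((((ν : ℝ) / p : ℝ)) : UnitAddCircle) -
        (∫ x, G x ∂haarAddCircle) * g P : ℝ) : ℂ) := by
    simp only [rootFractionSum, toComplexTest_apply, integral_complex_ofReal]
    push_cast
    ring
  rw [h1, Complex.norm_real, Real.norm_eq_abs] at hP
  exact hP

/-- **Weyl's criterion for the roots to prime moduli: Weyl sums ⇒ uniform distribution in
counting form.**  Let `f ∈ ℤ[X]` and `g : ℕ → ℝ`.  If `∑_{p ≤ P} S_f(h, p) = o(g(P))` for every
integer `h ≠ 0` and the number of fractions `ν/p` (`p ≤ P`) is `g(P) + o(g(P))`, then for all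
`0 ≤ α < β ≤ 1` the number of fractions in `[α, β)` is `(β − α) g(P) + o(g(P))`.
[cite: Weyl1916, §1 Satz 1, p. 315] (the same proof). -/
theorem counting_of_weylSums
    (hW : ∀ h : ℤ, h ≠ 0 → (fun P : ℕ => ∑ p ∈ Nat.primesLE P, polyRootWeylSum f p h) =o[atTop] g)
    (hN : (fun P : ℕ => (primeRootPairCount f 0 1 P : ℝ) - g P) =o[atTop] g)
    {α β : ℝ} (h0 : 0 ≤ α) (hαβ : α < β) (h1 : β ≤ 1) :
    (fun P : ℕ => (primeRootPairCount f α β P : ℝ) - (β - α) * g P) =o[atTop] g := by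
  rw [isLittleO_iff]
  intro c hc
  set m : ℝ := (α + β) / 2 with hm
  set r : ℝ := (β - α) / 2 with hr
  have hr0 : 0 < r := by rw [hr]; linarith
  set δ : ℝ := min (c / 4) (r / 2) with hδ
  have hδ0 : 0 < δ := lt_min (by positivity) (by positivity)
  have hδc : δ ≤ c / 4 := min_le_left _ _
  have hδr : δ < r := (min_le_right _ _).trans_lt (by linarith)
  -- Urysohn functions: `gp = 1` on the closed arc of radius `r`, `= 0` off the arc of radius `r + δ`
  obtain ⟨gp, hgp0, hgp1, hgp01⟩ := exists_continuous_zero_one_of_isClosed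
    (X := UnitAddCircle) (s := (Metric.ball ((m : ℝ) : UnitAddCircle) (r + δ))ᶜ)
    (t := Metric.closedBall ((m : ℝ) : UnitAddCircle) r)
    Metric.isOpen_ball.isClosed_compl Metric.isClosed_closedBall
    (Set.disjoint_compl_left_iff_subset.2 (Metric.closedBall_subset_ball (by linarith)))
  -- `gm = 1` on the closed arc of radius `r − δ`, `= 0` off the open arc of radius `r`
  obtain ⟨gm, hgm0, hgm1, hgm01⟩ := exists_continuous_zero_one_of_isClosed
    (X := UnitAddCircle) (s := (Metric.ball ((m : ℝ) : UnitAddCircle) r)ᶜ)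
    (t := Metric.closedBall ((m : ℝ) : UnitAddCircle) (r - δ))
    Metric.isOpen_ball.isClosed_compl Metric.isClosed_closedBall
    (Set.disjoint_compl_left_iff_subset.2 (Metric.closedBall_subset_ball (by linarith)))
  have hGp := abs_sub_le_of_isWeylGood gp (isWeylGood_of_weylSums hW hN (toComplexTest gp))
    (half_pos hc)
  have hGm := abs_sub_le_of_isWeylGood gm (isWeylGood_of_weylSums hW hN (toComplexTest gm))
    (half_pos hc)
  -- the integrals of the Urysohn functions
  have hIp : ∫ x, gp x ∂haarAddCircle ≤ β - α + 2 * δ := by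
    have h2 : ∫ x, gp x ∂haarAddCircle ≤
        ∫ x, (Metric.closedBall ((m : ℝ) : UnitAddCircle) (r + δ)).indicator 1 x ∂haarAddCircle := by
      refine integral_mono (integrable_continuousMap_addCircle_real gp)
        ((integrable_const 1).indicator Metric.isClosed_closedBall.measurableSet) fun x => ?_
      by_cases hx : x ∈ Metric.closedBall ((m : ℝ) : UnitAddCircle) (r + δ)
      · rw [Set.indicator_of_mem hx, Pi.one_apply]
        exact (hgp01 x).2
      · rw [Set.indicator_of_notMem hx]
        have hx' : x ∈ (Metric.ball ((m : ℝ) : UnitAddCircle) (r + δ))ᶜ :=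
          fun h => hx (Metric.ball_subset_closedBall h)
        exact (hgp0 hx').le
    rw [integral_indicator_one Metric.isClosed_closedBall.measurableSet,
      haarAddCircle_real_closedBall _ (by linarith)] at h2
    calc ∫ x, gp x ∂haarAddCircle ≤ min 1 (2 * (r + δ)) := h2
      _ ≤ 2 * (r + δ) := min_le_right _ _
      _ = β - α + 2 * δ := by rw [hr]; ring
  have hIm : β - α - 2 * δ ≤ ∫ x, gm x ∂haarAddCircle := by
    have h2 : ∫ x, (Metric.closedBall ((m : ℝ) : UnitAddCircle) (r - δ)).indicator 1 x ∂haarAddCircle ≤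
        ∫ x, gm x ∂haarAddCircle := by
      refine integral_mono ((integrable_const 1).indicator Metric.isClosed_closedBall.measurableSet)
        (integrable_continuousMap_addCircle_real gm) fun x => ?_
      by_cases hx : x ∈ Metric.closedBall ((m : ℝ) : UnitAddCircle) (r - δ)
      · rw [Set.indicator_of_mem hx, Pi.one_apply]
        exact (hgm1 hx).ge
      · rw [Set.indicator_of_notMem hx]
        exact (hgm01 x).1
    rw [integral_indicator_one Metric.isClosed_closedBall.measurableSet,
      haarAddCircle_real_closedBall _ (by linarith)] at h2
    have h3 : min 1 (2 * (r - δ)) = 2 * (r - δ) := min_eq_right (by rw [hr]; linarith)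
    rw [h3] at h2
    calc β - α - 2 * δ = 2 * (r - δ) := by rw [hr]; ring
      _ ≤ _ := h2
  filter_upwards [hGp, hGm, eventually_nonneg_of_count hN] with P hP hM hg
  have hgn : ‖g P‖ = g P := Real.norm_of_nonneg hg
  -- the count sits between the two test sums
  set Sp : ℝ := ∑ p ∈ Nat.primesLE P, ∑ ν ∈ (range p).filter (fun ν : ℕ => (p : ℤ) ∣ f.eval (ν : ℤ)),
      gp ((((ν : ℝ) / p : ℝ)) : UnitAddCircle) with hSp
  set Sm : ℝ := ∑ p ∈ Nat.primesLE P, ∑ ν ∈ (range p).filter (fun ν : ℕ => (p : ℤ) ∣ f.eval (ν : ℤ)),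
      gm ((((ν : ℝ) / p : ℝ)) : UnitAddCircle) with hSm
  have hcnt := primeRootPairCount_eq_sum_sum f α β P
  have hup : (primeRootPairCount f α β P : ℝ) ≤ Sp := by
    rw [hcnt, hSp]
    refine sum_le_sum fun p hp => sum_le_sum fun ν hν => ?_
    split_ifs with hI
    · have hmem := coe_mem_closedBall_of_mem_Ico hI
      rw [← hm, ← hr] at hmem
      exact (hgp1 hmem).symm.le
    · exact (hgp01 _).1
  have hlow : Sm ≤ (primeRootPairCount f α β P : ℝ) := by
    rw [hcnt, hSm]
    refine sum_le_sum fun p hp => sum_le_sum fun ν hν => ?_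
    have hp0 : (0 : ℝ) < p := by exact_mod_cast (Nat.mem_primesLE.mp hp).2.pos
    have hν0 : (0 : ℝ) ≤ (ν : ℝ) / p := by positivity
    have hν1 : (ν : ℝ) / p < 1 := (div_lt_one hp0).2 (by exact_mod_cast mem_range.1 (mem_filter.1 hν).1)
    split_ifs with hI
    · exact (hgm01 _).2
    · -- not in `[α, β)` ⇒ not in the open arc ⇒ `gm = 0`
      have hnot : ((((ν : ℝ) / p : ℝ)) : UnitAddCircle) ∈ (Metric.ball ((m : ℝ) : UnitAddCircle) r)ᶜ := by
        intro hball
        rw [hm, hr] at hball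
        have := mem_Ioo_of_coe_mem_ball h0 h1 hν0 hν1 hball
        exact hI ⟨this.1.le, this.2⟩
      exact (hgm0 hnot).le
  -- assemble
  rw [Real.norm_eq_abs, abs_le]
  constructor
  · -- lower bound
    have h2 : Sm - (∫ x, gm x ∂haarAddCircle) * g P ≥ -(c / 2 * ‖g P‖) := by
      have := (abs_le.1 hM).1
      linarith
    have h3 : (∫ x, gm x ∂haarAddCircle) * g P ≥ (β - α - 2 * δ) * g P :=
      mul_le_mul_of_nonneg_right hIm hg
    nlinarith [hlow, h2, h3, hg, hδc, hgn]
  · -- upper bound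
    have h2 : Sp - (∫ x, gp x ∂haarAddCircle) * g P ≤ c / 2 * ‖g P‖ := (abs_le.1 hP).2
    have h3 : (∫ x, gp x ∂haarAddCircle) * g P ≤ (β - α + 2 * δ) * g P :=
      mul_le_mul_of_nonneg_right hIp hg
    nlinarith [hup, h2, h3, hg, hδc, hgn]

/-! #### The criterion -/

/-- **Weyl's criterion for the roots of `f` to prime moduli** (both halves, abstract normaliser
`g`).  The following are equivalent: (i) for all `0 ≤ α < β ≤ 1` the number of fractions `ν/p`
(`p ≤ P` prime, `f(ν) ≡ 0 (mod p)`, `0 ≤ ν < p`) in `[α, β)` is `(β − α) g(P) + o(g(P))`;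
(ii) the number of fractions is `N(P) = g(P) + o(g(P))` and `∑_{p ≤ P} S_f(h, p) = o(g(P))` for
every integer `h ≠ 0`. [cite: Weyl1916, §1 Satz 1, p. 315] (for sequences; the block-by-block
version for this triangular array is the one used in
[cite: DukeFriedlanderIwaniec1995, main theorem]; cf. [cite: Kowalski2021, Theorem B.6.3]). -/
theorem counting_iff_weylSums :
    (∀ α β : ℝ, 0 ≤ α → α < β → β ≤ 1 →
      (fun P : ℕ => (primeRootPairCount f α β P : ℝ) - (β - α) * g P) =o[atTop] g) ↔
    ((fun P : ℕ => (primeRootPairCount f 0 1 P : ℝ) - g P) =o[atTop] g ∧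
      ∀ h : ℤ, h ≠ 0 →
        (fun P : ℕ => ∑ p ∈ Nat.primesLE P, polyRootWeylSum f p h) =o[atTop] g) := by
  constructor
  · intro hud
    have h01 : (fun P : ℕ => (primeRootPairCount f 0 1 P : ℝ) - g P) =o[atTop] g := by
      simpa only [sub_zero, one_mul] using hud 0 1 le_rfl one_pos le_rfl
    exact ⟨h01, fun h hh => isLittleO_sum_polyRootWeylSum_of_counting hud
      (isBigO_primeRootPairCount_of_counting (hud 0 1 le_rfl one_pos le_rfl)) hh⟩
  · rintro ⟨hN, hW⟩ α β h0 hαβ h1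
    exact counting_of_weylSums hW hN h0 hαβ h1

/-- **Weyl's criterion, classical normalisation** (by the number of terms `N(P)`): the fractions
`ν/p`, taken block by block, are uniformly distributed — for all `0 ≤ α < β ≤ 1` the number in
`[α, β)` is `(β − α) N(P) + o(N(P))` — iff `∑_{p ≤ P} S_f(h, p) = o(N(P))` for every integer
`h ≠ 0`. [cite: Weyl1916, §1 Satz 1, p. 315] -/
theorem counting_iff_weylSums_pairCount :
    (∀ α β : ℝ, 0 ≤ α → α < β → β ≤ 1 →
      (fun P : ℕ => (primeRootPairCount f α β P : ℝ) - (β - α) * primeRootPairCount f 0 1 P)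
        =o[atTop] fun P : ℕ => (primeRootPairCount f 0 1 P : ℝ)) ↔
    ∀ h : ℤ, h ≠ 0 → (fun P : ℕ => ∑ p ∈ Nat.primesLE P, polyRootWeylSum f p h) =o[atTop]
      fun P : ℕ => (primeRootPairCount f 0 1 P : ℝ) := by
  rw [counting_iff_weylSums]
  simp only [sub_self, isLittleO_zero, true_and]

end WeylToCounting

end Literature.NumberTheory.Sieve
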